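import Mathlib

/-!
# Oscillatory integration by parts on a period (2½-D no-go endgame bound)

For `ψ, b : ℝ → ℝ` of class `C¹` with `ψ 1 = ψ 0` and `b 1 = b 0`, and every `ε > 0`,

  `|∫₀¹ cos (ψ y / ε) · b y · ψ' y dy| ≤ ε · ∫₀¹ |b' y| dy`.

Proof: `cos (ψ/ε) ψ' = (ε sin (ψ/ε))'`, so one integration by parts on `[0,1]` gives
`∫₀¹ cos (ψ/ε) b ψ' = [b · ε sin (ψ/ε)]₀¹ − ∫₀¹ b' · ε sin (ψ/ε) = −∫₀¹ b' · ε sin (ψ/ε)` (the boundary term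
vanishes by periodicity), and `|b' · ε sin (ψ/ε)| ≤ ε |b'|` pointwise.

This is the tool stub `stub_oscillatoryIBP` of the line `Sketch` of the crux `HalfSpaceHierarchy`
(route `DyadicWallCascade`): it forces the head flux `F` of an `x`-independent witness to vanish.
-/

set_option linter.dupNamespace false

namespace Summit.AnomalousDissipation.AnomalousDissipation.Theorems.HalfSpaceHierarchy

open MeasureTheory Set

/-- The primitive of the oscillatory factor: `y ↦ ε sin (ψ y / ε)` has derivative `cos (ψ y / ε) ψ' y`
at every point, for `ψ` differentiable and `ε ≠ 0`. -/
private lemma oscIBP_hasDerivAt_eps_mul_sin {ψ : ℝ → ℝ} {ε : ℝ} (hε : ε ≠ 0) (hdψ : Differentiable ℝ ψ)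
    (y : ℝ) :
    HasDerivAt (fun x => ε * Real.sin (ψ x / ε)) (Real.cos (ψ y / ε) * deriv ψ y) y := by
  have h1 : HasDerivAt (fun x => ψ x / ε) (deriv ψ y / ε) y := (hdψ y).hasDerivAt.div_const ε
  have h2 : HasDerivAt (fun x => Real.sin (ψ x / ε)) (Real.cos (ψ y / ε) * (deriv ψ y / ε)) y :=
    (Real.hasDerivAt_sin _).comp y h1
  have h3 := h2.const_mul ε
  have e : ε * (Real.cos (ψ y / ε) * (deriv ψ y / ε)) = Real.cos (ψ y / ε) * deriv ψ y := by
    field_simp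
  rw [e] at h3
  exact h3

/-- Pointwise bound on the integrand after integration by parts:
`|b' y · (ε sin (ψ y / ε))| ≤ ε |b' y|` for `ε > 0`. -/
private lemma oscIBP_abs_mul_eps_sin_le {ψ : ℝ → ℝ} {ε : ℝ} (hε : 0 < ε) (c y : ℝ) :
    |c * (ε * Real.sin (ψ y / ε))| ≤ ε * |c| := by
  rw [abs_mul, abs_mul, abs_of_pos hε]
  have hs : |Real.sin (ψ y / ε)| ≤ 1 := Real.abs_sin_le_one _
  have hc : 0 ≤ |c| := abs_nonneg c
  calc |c| * (ε * |Real.sin (ψ y / ε)|) ≤ |c| * (ε * 1) := by gcongr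
    _ = ε * |c| := by ring

/-- **Oscillatory integration by parts (tool stub `stub_oscillatoryIBP`, line `Sketch`).**
For `C¹` functions `ψ, b : ℝ → ℝ` with `ψ 1 = ψ 0`, `b 1 = b 0` and every `ε > 0`,
`|∫₀¹ cos (ψ y / ε) b y ψ' y dy| ≤ ε ∫₀¹ |b' y| dy`: since `cos (ψ/ε) ψ' = (ε sin (ψ/ε))'`, integrating by
parts on `[0,1]` kills the boundary term by periodicity and leaves `−∫₀¹ b' · ε sin (ψ/ε)`, bounded by
`ε ∫₀¹ |b'|`. -/
theorem stub_oscillatoryIBP :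
    ∀ (ψ b : ℝ → ℝ) (ε : ℝ), 0 < ε → ContDiff ℝ 1 ψ → ContDiff ℝ 1 b → ψ 1 = ψ 0 → b 1 = b 0 →
      |∫ y in (0 : ℝ)..1, Real.cos (ψ y / ε) * b y * deriv ψ y| ≤ ε * ∫ y in (0 : ℝ)..1, |deriv b y| := by
  intro ψ b ε hε hψ hb hψp hbp
  have hdψ : Differentiable ℝ ψ := hψ.differentiable one_ne_zero
  have hdb : Differentiable ℝ b := hb.differentiable one_ne_zero
  have cψ : Continuous ψ := hψ.continuous
  have cψ' : Continuous (deriv ψ) := hψ.continuous_deriv le_rfl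
  have cb' : Continuous (deriv b) := hb.continuous_deriv le_rfl
  -- integration by parts with `u = b`, `v = ε sin (ψ/ε)`
  have hu : ∀ y ∈ uIcc (0 : ℝ) 1, HasDerivAt b (deriv b y) y := fun y _ => (hdb y).hasDerivAt
  have hv : ∀ y ∈ uIcc (0 : ℝ) 1,
      HasDerivAt (fun x => ε * Real.sin (ψ x / ε)) (Real.cos (ψ y / ε) * deriv ψ y) y :=
    fun y _ => oscIBP_hasDerivAt_eps_mul_sin hε.ne' hdψ y
  have hu' : IntervalIntegrable (deriv b) volume 0 1 := cb'.intervalIntegrable _ _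
  have hv' : IntervalIntegrable (fun y => Real.cos (ψ y / ε) * deriv ψ y) volume 0 1 :=
    (by fun_prop : Continuous fun y => Real.cos (ψ y / ε) * deriv ψ y).intervalIntegrable _ _
  have key := intervalIntegral.integral_mul_deriv_eq_deriv_mul hu hv hu' hv'
  -- the boundary term vanishes by periodicity
  have hbd : b 1 * (ε * Real.sin (ψ 1 / ε)) - b 0 * (ε * Real.sin (ψ 0 / ε)) = 0 := by
    rw [hψp, hbp, sub_self]
  have heq : ∫ y in (0 : ℝ)..1, Real.cos (ψ y / ε) * b y * deriv ψ y
      = -∫ y in (0 : ℝ)..1, deriv b y * (ε * Real.sin (ψ y / ε)) := by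
    have hswap : ∫ y in (0 : ℝ)..1, Real.cos (ψ y / ε) * b y * deriv ψ y
        = ∫ y in (0 : ℝ)..1, b y * (Real.cos (ψ y / ε) * deriv ψ y) :=
      intervalIntegral.integral_congr fun y _ => by ring
    rw [hswap, key, hbd, zero_sub]
  rw [heq, abs_neg]
  have hSc : Continuous fun y => ε * Real.sin (ψ y / ε) := by fun_prop
  calc |∫ y in (0 : ℝ)..1, deriv b y * (ε * Real.sin (ψ y / ε))|
      ≤ ∫ y in (0 : ℝ)..1, |deriv b y * (ε * Real.sin (ψ y / ε))| :=
        intervalIntegral.abs_integral_le_integral_abs zero_le_one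
    _ ≤ ∫ y in (0 : ℝ)..1, ε * |deriv b y| := by
        refine intervalIntegral.integral_mono_on zero_le_one ?_ ?_ ?_
        · exact (cb'.mul hSc).abs.intervalIntegrable _ _
        · exact (continuous_const.mul cb'.abs).intervalIntegrable _ _
        · intro y _
          exact oscIBP_abs_mul_eps_sin_le hε (deriv b y) y
    _ = ε * ∫ y in (0 : ℝ)..1, |deriv b y| := intervalIntegral.integral_const_mul _ _

end Summit.AnomalousDissipation.AnomalousDissipation.Theorems.HalfSpaceHierarchy
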